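import Literature.NumberTheory.DiophantineGeometry.AbcWave0
import Mathlib.NumberTheory.Height.NumberField
import HarnessLib

/-!
# Granville–Stark, Theorem 1 — height bookkeeping (proved lemmas)

Topic `NumberTheory/DiophantineGeometry` (family `abc`, record `abc.S22`).  First of three proofs-only
files (theorems only: no definitions, no named facts) formalising the deduction of
A. Granville, H. M. Stark, *ABC implies no "Siegel zeros" for `L`-functions of characters with
negative discriminant*, Invent. Math. 139 (2000), **Theorem 1** — the uniform `abc`-conjecture for
number fields (`Literature.NumberTheory.DiophantineGeometry.UniformABCConjecture`, their eq. (1)) implies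
`h(−d) ≥ (π/3 + o(1)) √d / log d` (`Literature.NumberTheory.DiophantineGeometry.ImaginaryQuadraticClassNumberBound`),
i.e. the named fact `Literature.NumberTheory.DiophantineGeometry.granville_stark` — from its two
classical inputs (integrality of the singular modulus `j(τ_d)` and Granville–Stark's Lemma 1 on the
root discriminant of `ℚ(√−d, γ₂(τ_d), γ₃(τ_d))`); the reduction itself is
`Literature.NumberTheory.DiophantineGeometry.granville_stark_of_cmInput`
(`AbcWave0GranvilleStarkTheorem1Proofs.lean`).

This file proves the pieces of the proof of Theorem 1 (§2, p. 5 of the paper) that are pure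
height bookkeeping over a number field `K` of degree `n`, in the relative normalisation of
`UniformABCConjecture` (Mathlib's `Height.mulHeight`, `NumberField.mulHeight_eq`):

* `prod_infinitePlace_apply_pow_mult_eq_prod_embeddings` — `∏_{w ∣ ∞} f(|x|_w)^{mult w} = ∏_{σ : K → ℂ} f(|σx|)`;
* `prod_algHom_apply_algebraMap_eq_pow`, `div_mul_log_le_log_prod_max` — the conjugates of `c`
  repeat `[K : ℚ(c)]` times, so one conjugate of size `|ι c|` gives
  `([K:ℚ]/h) · log⁺|ι c| ≤ log ∏_σ max(1, |σ c|)` as soon as `deg c ≤ h` (Granville–Stark (7):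
  `H(j(τ),1) = (∏_{τ*} max{|j(τ*)|, 1})^{1/h(−d)}`);
* `badPrimes_subset_of_forall`, `radicalNorm_le_absNorm_span`, `absNorm_span_singleton_eq_prod_embeddings`
  — the conductor of an integral triple is at most `|N(s)| = ∏_σ |σ s|` for any `s` divisible by
  every bad prime ("for any algebraic integer `α` one has `N(α, 1) ≤ H(α, 1)`", p. 5);
* `prod_max_le_mulHeight_triple` — `∏_σ max(1, |σ(g₂³)|) ≤ 1728ⁿ · H_K(g₃² : 1728 : g₂³)`
  (Granville–Stark (6): `H(j(τ), 1) ≤ H(j(τ), j(τ) − 1728, 1728)`, up to the harmless factor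
  `1728ⁿ` of the relative normalisation).

## Mathlib / tree search

Mathlib: `NumberField.mulHeight_eq`, `NumberField.absNorm_mul_finprod_finitePlace_eq_one`,
`InfinitePlace.card_filter_mk_eq`, `InfinitePlace.prod_eq_abs_norm`, `algHomEquivSigma`,
`AlgHom.card`, `Algebra.norm_eq_prod_embeddings`, `Ideal.finite_factors`, `Finset.prod_primes_dvd`,
`Ideal.absNorm_span_singleton` (all used).  Tree: `badPrimes`, `radicalNorm` (`AbcWave0.lean`);
`Literature.NumberTheory.EllipticCurves.prod_infinitePlace_pow_mult_eq_prod_embeddings`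
(`HeightsBaseChangeProofs.lean`, same conversion stated for functions of the place; not imported to
keep this file's imports to `AbcWave0` + Mathlib).

## References

* A. Granville, H. M. Stark, *ABC implies no "Siegel zeros" for `L`-functions of characters with
  negative discriminant*, Invent. Math. 139 (2000) 509–523, §1 eq. (1), §2 Lemma 1, proof of
  Theorem 1 with (5′), (6), (7) (held copy `paper:galaxy-pdf-4469120640`, pp. 1–5). [GranvilleStark2000]
* C. Táfula, *On Landau–Siegel zeros and heights of singular moduli*, Acta Arith. 201 (2021) 1–28
  (arXiv:1911.07215), §2.3 eq. (2.4), §5 Lemmas 5.4–5.5. [Tafula2021]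
-/

noncomputable section

open NumberField NumberField.InfinitePlace Height IsDedekindDomain

namespace Literature.NumberTheory.DiophantineGeometry

/-! ### Infinite places versus complex embeddings -/

section Places

variable {K : Type*} [Field K] [NumberField K]

/-- **Places with multiplicity are embeddings.** For a number field `K`, `x ∈ K` and any
`f : ℝ → ℝ`: `∏_{w ∣ ∞} f(|x|_w)^{mult w} = ∏_{σ : K →+* ℂ} f(|σ x|)` (each infinite place `w` is
`|σ ·|` for exactly `mult w` embeddings `σ`, Mathlib `InfinitePlace.card_filter_mk_eq`). [folklore] -/
theorem prod_infinitePlace_apply_pow_mult_eq_prod_embeddings (f : ℝ → ℝ) (x : K) :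
    ∏ w : InfinitePlace K, f (w x) ^ w.mult = ∏ φ : K →+* ℂ, f ‖φ x‖ := by
  classical
  rw [← Finset.prod_fiberwise Finset.univ mk (fun φ : K →+* ℂ => f ‖φ x‖)]
  refine Finset.prod_congr rfl fun w _ => ?_
  have (φ) (hφ : φ ∈ ({φ | mk φ = w} : Finset _)) : f ‖φ x‖ = f (w x) := by
    rw [← (Finset.mem_filter.mp hφ).2, apply]
  rw [Finset.prod_congr rfl this, Finset.prod_const, card_filter_mk_eq]

end Places

/-! ### Conjugates repeat `[F : ℚ(c)]` times -/

/-- **Tower multiplicity for functions of the conjugates.** For a tower of fields `k ⊆ L ⊆ F`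
(`F/k` finite separable), an algebraically closed `E` and any `g : E → M`:
`∏_{σ : F →ₐ[k] E} g(σ(y)) = (∏_{ψ : L →ₐ[k] E} g(ψ y))^{[F:L]}` for `y ∈ L` — every `ψ` has exactly
`[F : L]` extensions to `F` (Mathlib `algHomEquivSigma`, `AlgHom.card`; the case `g = id` is
Mathlib's `Algebra.prod_embeddings_eq_finrank_pow`). [folklore] -/
theorem prod_algHom_apply_algebraMap_eq_pow {k : Type*} [Field k] (L F E : Type*) [Field L] [Field F]
    [Field E] [Algebra k L] [Algebra k F] [Algebra k E] [Algebra L F] [IsScalarTower k L F]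
    [IsAlgClosed E] [Algebra.IsSeparable k F] [FiniteDimensional k F] [FiniteDimensional k L]
    {M : Type*} [CommMonoid M] (g : E → M) (y : L) :
    ∏ σ : F →ₐ[k] E, g (σ (algebraMap L F y)) = (∏ ψ : L →ₐ[k] E, g (ψ y)) ^ Module.finrank L F := by
  haveI : FiniteDimensional L F := FiniteDimensional.right k L F
  haveI : Algebra.IsSeparable L F := Algebra.isSeparable_tower_top_of_isSeparable k L F
  rw [Fintype.prod_equiv algHomEquivSigma (fun σ : F →ₐ[k] E => g (σ (algebraMap L F y)))
      (fun σ => g (σ.1 y)), ← Finset.univ_sigma_univ, Finset.prod_sigma, ← Finset.prod_pow]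
  · refine Finset.prod_congr rfl fun ψ _ => ?_
    letI : Algebra L E := ψ.toRingHom.toAlgebra
    show ∏ _s : (F →ₐ[L] E), g (ψ y) = _
    rw [Finset.prod_const, Finset.card_univ, AlgHom.card L F E]
  · intro σ
    simp only [algHomEquivSigma, Equiv.coe_fn_mk, AlgHom.restrictDomain, AlgHom.comp_apply,
      IsScalarTower.coe_toAlgHom']

section Conjugates

variable {F : Type*} [Field F] [NumberField F]

/-- **One large conjugate bounds the archimedean height from below.** If `c ∈ F` has degree
`deg c ≤ h` over `ℚ` and `ι : F → ℂ` is an embedding, then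
`([F:ℚ]/h) · log max(1, |ι c|) ≤ log ∏_{σ : F → ℂ} max(1, |σ c|)`: the conjugates of `c` are the
roots of its minimal polynomial, each repeated `[F : ℚ(c)] = [F:ℚ]/deg c ≥ [F:ℚ]/h` times, and
`ι c` is one of them.  This is Granville–Stark's (7),
`H(j(τ), 1) = (∏_{τ*} max{|j(τ*)|, 1})^{1/h(−d)}`, in the form "`≥ max{|j(τ)|,1}^{1/h}`" that the
class-number bound uses. [cite: GranvilleStark2000, §2 proof of Theorem 1, eq. (7)] -/
theorem div_mul_log_le_log_prod_max (ι : F →+* ℂ) (c : F) {h : ℕ} (hh : (minpoly ℚ c).natDegree ≤ h) :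
    (Module.finrank ℚ F : ℝ) / h * Real.log (max 1 ‖ι c‖) ≤
      Real.log (∏ φ : F →+* ℂ, max 1 ‖φ c‖) := by
  classical
  have hint : IsIntegral ℚ c := Algebra.IsIntegral.isIntegral c
  set L := IntermediateField.adjoin ℚ ({c} : Set F) with hL
  set y : L := IntermediateField.AdjoinSimple.gen ℚ c with hy
  have hyc : algebraMap L F y = c := IntermediateField.AdjoinSimple.algebraMap_gen ℚ c
  have hdegL : Module.finrank ℚ L = (minpoly ℚ c).natDegree := IntermediateField.adjoin.finrank hint
  have hdegpos : 0 < (minpoly ℚ c).natDegree := minpoly.natDegree_pos hint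
  have htower : Module.finrank ℚ L * Module.finrank L F = Module.finrank ℚ F :=
    Module.finrank_mul_finrank ℚ L F
  -- the product over ring homs is the product over `ℚ`-algebra homs
  have hprod : ∏ φ : F →+* ℂ, max 1 ‖φ c‖ = ∏ σ : F →ₐ[ℚ] ℂ, max 1 ‖σ c‖ :=
    Fintype.prod_equiv RingHom.equivRatAlgHom (fun f : F →+* ℂ => max 1 ‖f c‖)
      (fun σ : F →ₐ[ℚ] ℂ => max 1 ‖σ c‖) fun _ => by simp [RingHom.equivRatAlgHom_apply]
  have hkey := prod_algHom_apply_algebraMap_eq_pow (k := ℚ) L F ℂ (fun z : ℂ => max 1 ‖z‖) y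
  rw [hyc] at hkey
  -- one of the `ψ` is the restriction of `ι`
  set ψ₀ : L →ₐ[ℚ] ℂ := (ι.comp (algebraMap L F)).toRatAlgHom with hψ₀
  have hψ₀y : ψ₀ y = ι c := by
    show ι (algebraMap L F y) = ι c
    rw [hyc]
  have hP1 : ∀ ψ : L →ₐ[ℚ] ℂ, 1 ≤ max 1 ‖ψ y‖ := fun ψ => le_max_left _ _
  have hsingle : max 1 ‖ι c‖ ≤ ∏ ψ : L →ₐ[ℚ] ℂ, max 1 ‖ψ y‖ := by
    calc max 1 ‖ι c‖ = ∏ ψ : L →ₐ[ℚ] ℂ, (if ψ = ψ₀ then max 1 ‖ι c‖ else 1) := by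
          rw [Finset.prod_ite_eq']; simp
      _ ≤ ∏ ψ : L →ₐ[ℚ] ℂ, max 1 ‖ψ y‖ := by
          refine Finset.prod_le_prod (fun ψ _ => by split_ifs <;> positivity) fun ψ _ => ?_
          split_ifs with hψ
          · rw [hψ, hψ₀y]
          · exact hP1 ψ
  have hpos1 : 0 < max 1 ‖ι c‖ := by positivity
  rw [hprod, hkey, Real.log_pow]
  -- compare the multiplicities
  have hmul : (Module.finrank ℚ F : ℝ) / h ≤ (Module.finrank L F : ℝ) := by
    have hh0 : (0 : ℝ) < h := by exact_mod_cast hdegpos.trans_le hh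
    rw [div_le_iff₀ hh0]
    have e : (Module.finrank ℚ F : ℝ) = (minpoly ℚ c).natDegree * Module.finrank L F := by
      rw [← htower, hdegL]; push_cast; ring
    rw [e]
    have : ((minpoly ℚ c).natDegree : ℝ) ≤ h := by exact_mod_cast hh
    have h0 : (0 : ℝ) ≤ Module.finrank L F := Nat.cast_nonneg _
    nlinarith
  have hlog0 : 0 ≤ Real.log (max 1 ‖ι c‖) := Real.log_nonneg (le_max_left _ _)
  calc (Module.finrank ℚ F : ℝ) / h * Real.log (max 1 ‖ι c‖)
      ≤ (Module.finrank L F : ℝ) * Real.log (max 1 ‖ι c‖) := by gcongr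
    _ ≤ (Module.finrank L F : ℝ) * Real.log (∏ ψ : L →ₐ[ℚ] ℂ, max 1 ‖ψ y‖) := by gcongr

end Conjugates

/-! ### The conductor of an integral triple -/

section Conductor

variable {K : Type*} [Field K] [NumberField K]

/-- **Bad primes divide a common multiple.** If every prime `𝔭 ∌ s` of `𝓞 K` contains none of
`a, b, c ∈ 𝓞 K`, then the primes at which the valuations of `a, b, c` are not all equal
(`Literature.NumberTheory.DiophantineGeometry.badPrimes`) all contain `s`: at such `𝔭` the three
valuations are `0` (Mathlib `HeightOneSpectrum.valuation_eq_one_iff_notMem`). [folklore] -/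
theorem badPrimes_subset_of_forall {a b c s : 𝓞 K}
    (h : ∀ v : HeightOneSpectrum (𝓞 K), s ∉ v.asIdeal → a ∉ v.asIdeal ∧ b ∉ v.asIdeal ∧ c ∉ v.asIdeal) :
    badPrimes (a : K) b c ⊆ {v | s ∈ v.asIdeal} := by
  intro v hv
  by_contra hs
  obtain ⟨ha, hb, hc⟩ := h v hs
  apply hv
  rw [show (a : K) = algebraMap (𝓞 K) K a from rfl, show (b : K) = algebraMap (𝓞 K) K b from rfl,
    show (c : K) = algebraMap (𝓞 K) K c from rfl,
    (v.valuation_eq_one_iff_notMem).mpr ha, (v.valuation_eq_one_iff_notMem).mpr hb,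
    (v.valuation_eq_one_iff_notMem).mpr hc]
  exact ⟨rfl, rfl⟩

/-- **The radical norm is at most `|N(s)|`** for any `s ≠ 0` lying in every bad prime:
`N_K(a, b, c) = ∏_{𝔭 bad} N𝔭 ≤ ∏_{𝔭 ∋ s} N𝔭 ≤ N((s))`, the distinct primes containing `s` having
product dividing `(s)` (Granville–Stark, p. 5: "for any algebraic integer `α` one has
`N(α, 1) ≤ H(α, 1)`", applied to `N_K(γ₂³, γ₃², 1728) ≪ N_K(γ₂,1) N_K(γ₃,1)`).
[cite: GranvilleStark2000, §2 proof of Theorem 1] -/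
theorem radicalNorm_le_absNorm_span {a b c s : 𝓞 K} (hs : s ≠ 0)
    (h : badPrimes (a : K) b c ⊆ {v | s ∈ v.asIdeal}) :
    radicalNorm (a : K) b c ≤ Ideal.absNorm (Ideal.span {s}) := by
  classical
  set T : Set (HeightOneSpectrum (𝓞 K)) := {v | s ∈ v.asIdeal} with hTdef
  have hI : Ideal.span {s} ≠ ⊥ := by rwa [Ne, Ideal.span_singleton_eq_bot]
  have hT : T.Finite := by
    refine (Ideal.finite_factors hI).subset fun v hv => ?_
    show v.asIdeal ∣ Ideal.span {s}
    exact Ideal.dvd_span_singleton.mpr hv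
  have hbad : (badPrimes (a : K) b c).Finite := hT.subset h
  -- `radicalNorm ≤ ∏_{v ∈ T} N v`
  have h1 : radicalNorm (a : K) b c ≤ ∏ v ∈ hT.toFinset, Ideal.absNorm v.asIdeal := by
    rw [radicalNorm, finprod_mem_eq_finite_toFinset_prod _ hbad]
    refine Finset.prod_le_prod_of_subset_of_one_le' (by simpa using h) fun v _ _ => ?_
    exact Nat.one_le_iff_ne_zero.mpr (by rw [Ne, Ideal.absNorm_eq_zero_iff]; exact v.ne_bot)
  -- `∏_{v ∈ T} v ∣ (s)`
  have h2 : ∏ v ∈ hT.toFinset, v.asIdeal ∣ Ideal.span {s} := by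
    rw [← Finset.prod_image (g := HeightOneSpectrum.asIdeal) (f := fun p => p)
      (fun v _ w _ hvw => HeightOneSpectrum.ext hvw)]
    refine Finset.prod_primes_dvd _ (fun p hp => ?_) (fun p hp => ?_)
    · obtain ⟨v, -, rfl⟩ := Finset.mem_image.mp hp
      exact v.prime
    · obtain ⟨v, hv, rfl⟩ := Finset.mem_image.mp hp
      rw [Set.Finite.mem_toFinset] at hv
      exact Ideal.dvd_span_singleton.mpr hv
  have h3 : ∏ v ∈ hT.toFinset, Ideal.absNorm v.asIdeal ∣ Ideal.absNorm (Ideal.span {s}) := by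
    rw [← map_prod]
    exact map_dvd Ideal.absNorm h2
  have h4 : Ideal.absNorm (Ideal.span {s}) ≠ 0 := by
    rw [Ne, Ideal.absNorm_eq_zero_iff]; exact hI
  exact h1.trans (Nat.le_of_dvd (Nat.pos_of_ne_zero h4) h3)

/-- `|N_{K/ℚ}(s)| = ∏_{σ : K → ℂ} |σ s|` for an algebraic integer `s`, with the left side read as the
absolute norm of the ideal `(s)` (Mathlib `Ideal.absNorm_span_singleton`,
`Algebra.norm_eq_prod_embeddings`). [folklore] -/
theorem absNorm_span_singleton_eq_prod_embeddings (s : 𝓞 K) :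
    (Ideal.absNorm (Ideal.span {s}) : ℝ) = ∏ φ : K →+* ℂ, ‖φ s‖ := by
  rw [Ideal.absNorm_span_singleton]
  have h1 : ((Algebra.norm ℤ s).natAbs : ℝ) = |(Algebra.norm ℚ (s : K) : ℝ)| := by
    rw [← Algebra.coe_norm_int, Nat.cast_natAbs, Int.cast_abs]
    push_cast
    rfl
  rw [h1]
  have h2 := Algebra.norm_eq_prod_embeddings ℚ ℂ (s : K)
  have h3 : ‖(algebraMap ℚ ℂ) (Algebra.norm ℚ (s : K))‖ = |(Algebra.norm ℚ (s : K) : ℝ)| := by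
    rw [eq_ratCast, ← Real.norm_eq_abs, ← Complex.norm_real, Complex.ofReal_ratCast]
  rw [← h3, h2, norm_prod]
  exact (Fintype.prod_equiv RingHom.equivRatAlgHom (fun f : K →+* ℂ => ‖f (s : K)‖)
    (fun φ : K →ₐ[ℚ] ℂ => ‖φ (s : K)‖) fun _ => by simp [RingHom.equivRatAlgHom_apply]).symm

end Conductor

/-! ### The height of the triple `(g₃² : 1728 : g₂³)` from below -/

section Triple

variable {K : Type*} [Field K] [NumberField K]

/-- **`H(j, 1) ≤ H(j, j − 1728, 1728)` in relative normalisation.** For algebraic integers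
`g₂, g₃` of a number field `K` of degree `n`:
`∏_{σ : K → ℂ} max(1, |σ(g₂³)|) ≤ 1728ⁿ · H_K(g₃² : 1728 : g₂³)`, where `H_K = Height.mulHeight` is
Mathlib's relative multiplicative height: its archimedean factor dominates `∏_σ max(1, |σ(g₂³)|)`
because the coordinate `1728` is `≥ 1` at every infinite place, and its non-archimedean factor is
`N(𝔞)⁻¹ ≥ 1728⁻ⁿ` for the integral ideal `𝔞 = (g₃², 1728, g₂³) ∋ 1728`
(Mathlib `NumberField.absNorm_mul_finprod_finitePlace_eq_one`).  Granville–Stark (6):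
`H(j(τ), 1) ≤ H(j(τ), j(τ) − 1728, 1728)`. [cite: GranvilleStark2000, §2 proof of Theorem 1, eq. (6)] -/
theorem prod_max_le_mulHeight_triple (g₂ g₃ : 𝓞 K) :
    ∏ φ : K →+* ℂ, max 1 ‖φ ((g₂ : K) ^ 3)‖ ≤
      (1728 : ℝ) ^ Module.finrank ℚ K * mulHeight ![((g₃ : K)) ^ 2, (1728 : K), (g₂ : K) ^ 3] := by
  classical
  set x : Fin 3 → 𝓞 K := ![g₃ ^ 2, 1728, g₂ ^ 3] with hxdef
  have hx1 : x 1 = 1728 := rfl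
  have hx0 : x ≠ 0 := by
    intro h
    have := congrFun h 1
    rw [hx1, Pi.zero_apply] at this
    exact absurd this (by norm_num)
  have h1728 : ((1728 : 𝓞 K) : K) = 1728 := by rw [RingOfIntegers.coe_eq_algebraMap, map_ofNat]
  set xK : Fin 3 → K := fun i => (x i : K) with hxK
  have hxK_eq : xK = ![((g₃ : K)) ^ 2, (1728 : K), (g₂ : K) ^ 3] := by
    ext i
    fin_cases i <;> simp [hxK, hxdef, h1728]
  have hxK0 : xK ≠ 0 := by
    intro h
    have := congrFun h 1
    simp [hxK, hx1] at this
  rw [← hxK_eq, NumberField.mulHeight_eq hxK0]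
  -- non-archimedean part
  have hfin := NumberField.absNorm_mul_finprod_finitePlace_eq_one hx0
  set N := Ideal.absNorm (Ideal.span (Set.range x)) with hN
  set FP := ∏ᶠ v : FinitePlace K, ⨆ i, v (xK i) with hFP
  have hfin' : (N : ℝ) * FP = 1 := hfin
  have hNle : N ≤ 1728 ^ Module.finrank ℚ K := by
    have hle : Ideal.span {(1728 : 𝓞 K)} ≤ Ideal.span (Set.range x) := by
      rw [Ideal.span_singleton_le_iff_mem]
      exact Ideal.subset_span ⟨1, hx1⟩
    have hdvd := Ideal.absNorm_dvd_absNorm_of_le hle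
    have h1728' : Ideal.absNorm (Ideal.span {(1728 : 𝓞 K)}) = 1728 ^ Module.finrank ℚ K := by
      rw [Ideal.absNorm_span_singleton, show (1728 : 𝓞 K) = algebraMap ℤ (𝓞 K) 1728 by simp,
        Algebra.norm_algebraMap, RingOfIntegers.rank]
      simp [Int.natAbs_pow]
    rw [h1728'] at hdvd
    exact Nat.le_of_dvd (by positivity) hdvd
  have hNpos : (0 : ℝ) < N := by
    have : N ≠ 0 := by
      intro h0
      rw [h0, Nat.cast_zero, zero_mul] at hfin'
      exact zero_ne_one hfin'
    positivity
  have hFP1 : (1 : ℝ) ≤ 1728 ^ Module.finrank ℚ K * FP := by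
    have e : FP = (N : ℝ)⁻¹ := by
      field_simp
      linarith [hfin']
    rw [e, ← div_eq_mul_inv, one_le_div hNpos]
    exact_mod_cast hNle
  -- archimedean part
  have hinf : ∏ φ : K →+* ℂ, max 1 ‖φ ((g₂ : K) ^ 3)‖ ≤
      ∏ w : InfinitePlace K, (⨆ i, w (xK i)) ^ w.mult := by
    rw [← prod_infinitePlace_apply_pow_mult_eq_prod_embeddings (fun t => max 1 t) ((g₂ : K) ^ 3)]
    refine Finset.prod_le_prod (fun w _ => by positivity) fun w _ => ?_
    refine pow_le_pow_left₀ (by positivity) (max_le ?_ ?_) _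
    · refine Finite.le_ciSup_of_le 1 ?_
      simp only [hxK, hx1, h1728]
      rw [show (1728 : K) = ((1728 : ℕ) : K) by norm_num, InfinitePlace.map_natCast]
      norm_num
    · exact Finite.le_ciSup_of_le 2 (by simp [hxK, hxdef])
  have hIPnn : 0 ≤ ∏ w : InfinitePlace K, (⨆ i, w (xK i)) ^ w.mult :=
    Finset.prod_nonneg fun w _ => pow_nonneg (Real.iSup_nonneg_of_nonnegHomClass ..) _
  have hFPnn : 0 ≤ FP := finprod_nonneg fun _ => Real.iSup_nonneg_of_nonnegHomClass ..
  calc ∏ φ : K →+* ℂ, max 1 ‖φ ((g₂ : K) ^ 3)‖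
      ≤ (∏ w : InfinitePlace K, (⨆ i, w (xK i)) ^ w.mult) * 1 := by rw [mul_one]; exact hinf
    _ ≤ (∏ w : InfinitePlace K, (⨆ i, w (xK i)) ^ w.mult) * (1728 ^ Module.finrank ℚ K * FP) := by
        gcongr
    _ = _ := by ring

end Triple

end Literature.NumberTheory.DiophantineGeometry

end
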